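import Summits.ValiantsHypothesis.ValiantsHypothesis.Theorems.BarrierLeverAnchoredDoorHitsLowerPairsStarCertificates

/-!
# Route BarrierLever — support item `AnchoredDoorHitsLowerPairs` (stmt-ValiantsHypothesis-22510), line `anchored_peeling`:
# TYPED CERTIFICATE CLASSES OF THE STAR-FOREST MATRIX (val-np-p1 g31)

Two predicates on a layout `(u, w)` naming the certificate classes of this generation, so that the registry can exclude them from the
residual nodes by name (pattern of `EvalGP.IsCompressed` / `EvalGP.IsFrobCert`), with their door-level consequences:
* `StarDoor.IsEvalCert u w` — some pure evaluation matrix `(∏_{b' ∈ u i} Σ_{e ∈ w j} θ_{b'e})` is nonsingular (the evaluation face; by the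
  RANK LAW of the memo this is the case exactly when `f_u(≤k) ≤ f_w(≤k)` for all `k`, up to parity accidents);
* `StarDoor.IsVFCert u w` — the VERTEX–FACET COFACTOR class: a vertex row `{b}` at `i₀`, a nonempty ⊆-maximal column at `j₀`, and a nonzero
  `(j₀, i₀)` adjugate entry of some pure evaluation matrix (memo §9b/§11: every corank-1 lower pair computed is in this class).
Consequences for injective lower pairs: `symbolicDet 2 h r u w ≠ 0` and `AnchoredHit 2 h r u w` for either class and for either orientation of
the evaluation class (`symbolicDet_two_ne_zero_of_isEvalCert(_swap)`, `symbolicDet_two_ne_zero_of_isVFCert`, …). WHY THESE MIGHT NOT SUFFICE: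
pairs with `min(corank E, corank Eᵀ) ≥ 2` and fewer than `corank` usable facets (memo §9b) lie outside both; they are descent-good on paper only.
Nothing here bears on crux 14610 or on `VP ≠ VNP`.
-/

set_option linter.dupNamespace false

namespace Summit.ValiantsHypothesis.ValiantsHypothesis.Theorems.BarrierLever.AnchoredPeeling

open Finset

noncomputable section

namespace StarDoor

variable {h r : ℕ}

/-- **Evaluation certificate class:** some pure evaluation matrix `(∏_{b' ∈ u i} Σ_{e ∈ w j} θ_{b'e})_{ij}` of the layout is nonsingular. -/
def IsEvalCert (u w : Fin r → Finset (Fin h)) : Prop :=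
  ∃ θ : Fin h → Fin h → ℂ, (Matrix.of fun i j : Fin r => ∏ b' ∈ u i, ∑ e ∈ w j, θ b' e).det ≠ 0

/-- **Vertex–facet cofactor certificate class:** a vertex row `u i₀ = {b}`, a nonempty column `w j₀` that is ⊆-maximal among the columns, and a
nonzero `(j₀, i₀)` adjugate entry (the cofactor complementary to that row and column) of some pure evaluation matrix of the layout. -/
def IsVFCert (u w : Fin r → Finset (Fin h)) : Prop :=
  ∃ (b : Fin h) (i₀ j₀ : Fin r), u i₀ = {b} ∧ (w j₀).Nonempty ∧ (∀ j, w j₀ ⊆ w j → w j = w j₀) ∧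
    ∃ θ : Fin h → Fin h → ℂ, (Matrix.of fun i j : Fin r => ∏ b' ∈ u i, ∑ e ∈ w j, θ b' e).adjugate j₀ i₀ ≠ 0

/-- The evaluation class gives `symbolicDet 2 ≠ 0` on an injective lower pair. -/
theorem symbolicDet_two_ne_zero_of_isEvalCert (u w : Fin r → Finset (Fin h)) (hu : Function.Injective u) (hw : Function.Injective w)
    (hlu : IsLowerSet (Set.range u)) (hlw : IsLowerSet (Set.range w)) (hE : IsEvalCert u w) : symbolicDet 2 h r u w ≠ 0 := by
  obtain ⟨g, d, hdet⟩ := starDet_ne_zero_of_evalDet u w hE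
  exact symbolicDet_two_ne_zero_of_starDet g d u w hu hw hlu hlw hdet

/-- The evaluation class of the SWAPPED layout also gives `symbolicDet 2 ≠ 0` (transposed evaluation face). -/
theorem symbolicDet_two_ne_zero_of_isEvalCert_swap (u w : Fin r → Finset (Fin h)) (hu : Function.Injective u) (hw : Function.Injective w)
    (hlu : IsLowerSet (Set.range u)) (hlw : IsLowerSet (Set.range w)) (hE : IsEvalCert w u) : symbolicDet 2 h r u w ≠ 0 := by
  obtain ⟨g, d, hdet⟩ := starDet_ne_zero_of_evalDet_swap u w hE
  exact symbolicDet_two_ne_zero_of_starDet g d u w hu hw hlu hlw hdet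

/-- The vertex–facet class gives `symbolicDet 2 ≠ 0` on an injective lower pair. -/
theorem symbolicDet_two_ne_zero_of_isVFCert (u w : Fin r → Finset (Fin h)) (hu : Function.Injective u) (hw : Function.Injective w)
    (hlu : IsLowerSet (Set.range u)) (hlw : IsLowerSet (Set.range w)) (hV : IsVFCert u w) : symbolicDet 2 h r u w ≠ 0 := by
  obtain ⟨b, i₀, j₀, hb, hT, hmax, hcof⟩ := hV
  exact symbolicDet_two_ne_zero_of_cofactor u w hu hw hlu hlw b i₀ j₀ hb hT hmax hcof

/-- The vertex–facet class of the SWAPPED layout gives `symbolicDet 2 ≠ 0` as well (`symbolicDet_ne_zero_swap`). -/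
theorem symbolicDet_two_ne_zero_of_isVFCert_swap (u w : Fin r → Finset (Fin h)) (hu : Function.Injective u) (hw : Function.Injective w)
    (hlu : IsLowerSet (Set.range u)) (hlw : IsLowerSet (Set.range w)) (hV : IsVFCert w u) : symbolicDet 2 h r u w ≠ 0 :=
  symbolicDet_ne_zero_swap 2 h r u w (symbolicDet_two_ne_zero_of_isVFCert w u hw hu hlw hlu hV)

/-- Either class, in either orientation, gives an anchored hit of profile 2. -/
theorem anchoredHit_two_of_certClasses (u w : Fin r → Finset (Fin h)) (hu : Function.Injective u) (hw : Function.Injective w)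
    (hlu : IsLowerSet (Set.range u)) (hlw : IsLowerSet (Set.range w))
    (hc : IsEvalCert u w ∨ IsEvalCert w u ∨ IsVFCert u w ∨ IsVFCert w u) : AnchoredHit 2 h r u w := by
  apply stub_genericPoint 2 h r u w
  rcases hc with hc | hc | hc | hc
  · exact symbolicDet_two_ne_zero_of_isEvalCert u w hu hw hlu hlw hc
  · exact symbolicDet_two_ne_zero_of_isEvalCert_swap u w hu hw hlu hlw hc
  · exact symbolicDet_two_ne_zero_of_isVFCert u w hu hw hlu hlw hc
  · exact symbolicDet_two_ne_zero_of_isVFCert_swap u w hu hw hlu hlw hc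

end StarDoor

end

end Summit.ValiantsHypothesis.ValiantsHypothesis.Theorems.BarrierLever.AnchoredPeeling
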